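import Summits.Ventures.PackingBounds.Energy.FivePointRieszTwo
import Summits.Ventures.PackingBounds.Energy.ThreePointEnergyDeficit
import Summits.Ventures.PackingBounds.Energy.FivePointBipyramidRigidity
import HarnessLib

/-!
# Five points on `S²`, Riesz 2-energy: every minimiser is a triangular bipyramid (rigidity)

Framing: lottery ticket; floor = certified bounds/negative ranges. Venture `PackingBounds`, cell
`pub-packcert`, energy family E3PT (pub-packcert-energy gen 11).

Complementary slackness for the kernel-checked sharp certificate `FivePointRieszTwo.riesz_two_five_points`
(gen 10): if five unit vectors `C ⊂ ℝ³` attain `Σ_{x≠y} 1/‖x-y‖² = 17/2`, then every inner product of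
distinct points lies in `{-1, 0, -1/2}` (equality in `p ≤ 1/(2-2t)`, `1-(2-2t)p(t) = t²(1+t)(1+2t)²/18`),
`Σ x = 0` (two-point multiplier `a₁ > 0`, `ThreePointDeficit`), hence `C` is a triangular bipyramid
(`Bipyramid5.rigid`).
-/

noncomputable section

open Finset
open scoped RealInnerProductSpace

namespace Summit.Ventures.PackingBounds.Energy.FivePointRieszTwo

open Literature.Geometry.DiscreteGeometry Literature.Geometry.DiscreteGeometry.BachocVallentin
open Literature.Analysis.SpecialFunctions

/-- Equality in the Hermite minorant `p(t) ≤ 1/(2-2t)` on `[-1,1)` forces `t ∈ {-1, 0, -1/2}`. -/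
theorem inner_of_pmin_eq (t : ℝ) (h1 : -1 ≤ t) (h2 : t < 1) (heq : pmin t = 1 / (2 - 2 * t)) :
    t = -1 ∨ t = 0 ∨ t = -1 / 2 := by
  have hpos : 0 < 2 - 2 * t := by linarith
  have hm : (2 - 2 * t) * pmin t = 1 := by rw [heq, mul_one_div, div_self hpos.ne']
  have hz : t ^ 2 * (1 + t) * (1 + 2 * t) ^ 2 = 0 := by
    unfold pmin at hm; nlinarith [hm]
  rcases mul_eq_zero.1 hz with h | h
  · rcases mul_eq_zero.1 h with h' | h'
    · right; left; exact (pow_eq_zero_iff two_ne_zero).1 h'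
    · left; linarith
  · right; right
    have := (pow_eq_zero_iff two_ne_zero).1 h
    linarith

/-- **Rigidity of the Riesz 2-energy ground state of five points.** If five unit vectors of `ℝ³`
attain `Σ_{x≠y} 1/‖x-y‖² = 17/2`, then all inner products of distinct points lie in `{-1, 0, -1/2}`,
`Σ x = 0`, and the configuration is a triangular bipyramid. -/
theorem riesz_two_five_points_rigid (C : Finset (EuclideanSpace ℝ (Fin 3))) (hC : ∀ x ∈ C, ‖x‖ = 1)
    (h5 : C.card = 5)
    (hmin : ∑ x ∈ C, ∑ y ∈ C.erase x, 1 / ‖x - y‖ ^ 2 = 17 / 2) :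
    (∀ x ∈ C, ∀ y ∈ C, x ≠ y → inner ℝ x y = -1 ∨ inner ℝ x y = 0 ∨ inner ℝ x y = -1 / 2)
    ∧ (∑ x ∈ C, x = 0)
    ∧ ∃ p ∈ C, -p ∈ C ∧ (∀ z ∈ C, z ≠ p → z ≠ -p → inner ℝ z p = 0)
        ∧ (∀ z ∈ C, ∀ w ∈ C, z ≠ p → z ≠ -p → w ≠ p → w ≠ -p → z ≠ w → inner ℝ z w = -1 / 2) := by
  classical
  have hA := pairSum_gegenbauer_comb_nonneg (n := 3) (by norm_num) 1 aco aco_nonneg C hC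
  have hF := tripleSum_threePointF3_nonneg 4 4 dco dco_nonneg gw C hC
  have hcard : (C.card : ℝ) = 5 := by exact_mod_cast h5
  have hAeval : ∀ w : ℝ, (∑ k ∈ range (1 + 1), aco k * gegenbauerSum ((((3 : ℕ) : ℝ) - 2) / 2) k w)
      = a1 * w := by
    intro w
    have h0 : aco 0 = 0 := rfl
    have h1 : aco 1 = a1 := rfl
    simp only [Finset.sum_range_succ, Finset.sum_range_zero, h0, h1, gegenbauerSum_one, gegenbauerSum_zero]
    push_cast
    ring
  have hineq : ∀ u v t : ℝ, -1 ≤ u → u < 1 → -1 ≤ v → v < 1 → -1 ≤ t → t < 1 →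
      0 ≤ 1 + 2 * u * v * t - u ^ 2 - v ^ 2 - t ^ 2 →
      c0 + ((C.card : ℝ) - 2) * threePointF3 4 4 dco gw u v t + threePointF3 4 4 dco gw u u 1
        + threePointF3 4 4 dco gw v v 1 + threePointF3 4 4 dco gw t t 1
        + ((fun w => ∑ k ∈ range (1 + 1), aco k * gegenbauerSum ((((3 : ℕ) : ℝ) - 2) / 2) k w) u
          + (fun w => ∑ k ∈ range (1 + 1), aco k * gegenbauerSum ((((3 : ℕ) : ℝ) - 2) / 2) k w) v
          + (fun w => ∑ k ∈ range (1 + 1), aco k * gegenbauerSum ((((3 : ℕ) : ℝ) - 2) / 2) k w) t) / 3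
        ≤ (pmin u + pmin v + pmin t) / 3 := by
    intro u v t hu1 hu2 hv1 hv2 ht1 ht2 hdet
    simp only [hAeval, hcard, threePointF3_eq]
    have h1 := sos_identity u v t
    have h2 := sosR_nonneg u v t
    linarith
  have key := CohnWoo.energy_ge_of_threePoint C hC (by omega) pmin _ _ c0 hA hF
    (threePointF3_swap12 4 4 dco gw) (threePointF3_swap23 4 4 dco gw) hineq
  have key' := key
  simp only [hAeval, hcard, threePointF3_eq] at key'
  have hb : (5 : ℝ) * ((5 - 1) * c0 - Fexp 1 1 1 - a1 * 1) = 17 / 2 := by norm_num [c0, Fexp, a1]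
  rw [hb] at key'
  -- pointwise minorant and termwise equality
  have hle : ∀ x ∈ C, ∀ y ∈ C.erase x, pmin (inner ℝ x y) ≤ 1 / ‖x - y‖ ^ 2 := by
    intro x hx y hy
    have hyC : y ∈ C := Finset.mem_of_mem_erase hy
    have hxy : x ≠ y := fun h => (Finset.ne_of_mem_erase hy) h.symm
    have hlo : -1 ≤ inner ℝ x y := neg_one_le_real_inner_of_norm_eq_one (hC x hx) (hC y hyC)
    have hne : inner ℝ x y ≠ 1 := fun h1 =>
      hxy ((inner_eq_one_iff_of_norm_eq_one (𝕜 := ℝ) (hC x hx) (hC y hyC)).1 h1)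
    have hhi : inner ℝ x y < 1 := lt_of_le_of_ne (real_inner_le_one_of_norm_eq_one (hC x hx) (hC y hyC)) hne
    have hnorm : ‖x - y‖ ^ 2 = 2 - 2 * inner ℝ x y := by
      rw [@norm_sub_sq_real, hC x hx, hC y hyC]; ring
    rw [hnorm]
    exact pmin_le _ hlo hhi
  have hsumle : ∑ x ∈ C, ∑ y ∈ C.erase x, pmin (inner ℝ x y) ≤ ∑ x ∈ C, ∑ y ∈ C.erase x, 1 / ‖x - y‖ ^ 2 :=
    Finset.sum_le_sum fun x hx => Finset.sum_le_sum fun y hy => hle x hx y hy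
  have hEqP : ∑ x ∈ C, ∑ y ∈ C.erase x, pmin (inner ℝ x y) = 17 / 2 := by
    apply le_antisymm _ key'
    rw [← hmin]; exact hsumle
  have hEq2 : ∑ x ∈ C, ∑ y ∈ C.erase x, pmin (inner ℝ x y) = ∑ x ∈ C, ∑ y ∈ C.erase x, 1 / ‖x - y‖ ^ 2 := by
    rw [hEqP, hmin]
  have hterm : ∀ x ∈ C, ∀ y ∈ C.erase x, pmin (inner ℝ x y) = 1 / ‖x - y‖ ^ 2 := by
    have houter := (Finset.sum_eq_sum_iff_of_le (fun x hx => Finset.sum_le_sum fun y hy => hle x hx y hy)).1 hEq2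
    intro x hx
    exact (Finset.sum_eq_sum_iff_of_le (fun y hy => hle x hx y hy)).1 (houter x hx)
  have hvals : ∀ x ∈ C, ∀ y ∈ C, x ≠ y → inner ℝ x y = -1 ∨ inner ℝ x y = 0 ∨ inner ℝ x y = -1 / 2 := by
    intro x hx y hy hxy
    have hy' : y ∈ C.erase x := Finset.mem_erase.2 ⟨fun h => hxy h.symm, hy⟩
    have hlo : -1 ≤ inner ℝ x y := neg_one_le_real_inner_of_norm_eq_one (hC x hx) (hC y hy)
    have hne : inner ℝ x y ≠ 1 := fun h1 =>
      hxy ((inner_eq_one_iff_of_norm_eq_one (𝕜 := ℝ) (hC x hx) (hC y hy)).1 h1)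
    have hhi : inner ℝ x y < 1 := lt_of_le_of_ne (real_inner_le_one_of_norm_eq_one (hC x hx) (hC y hy)) hne
    have hnorm : ‖x - y‖ ^ 2 = 2 - 2 * inner ℝ x y := by
      rw [@norm_sub_sq_real, hC x hx, hC y hy]; ring
    have h := hterm x hx y hy'
    rw [hnorm] at h
    exact inner_of_pmin_eq _ hlo hhi h
  -- balanced
  have hsharp : ∑ x ∈ C, ∑ y ∈ C.erase x, pmin (inner ℝ x y)
      = (C.card : ℝ) * (((C.card : ℝ) - 1) * c0 - threePointF3 4 4 dco gw 1 1 1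
        - (fun w => ∑ k ∈ range (1 + 1), aco k * gegenbauerSum ((((3 : ℕ) : ℝ) - 2) / 2) k w) 1) := by
    simp only [hAeval, hcard, threePointF3_eq]
    rw [hEqP, ← hb]
  obtain ⟨hA0, -⟩ := ThreePointDeficit.pairSum_eq_zero_of_sharp C hC (by omega) pmin _ _ c0 hA hF
    (threePointF3_swap12 4 4 dco gw) (threePointF3_swap23 4 4 dco gw) hineq hsharp
  have hfun : (fun w => ∑ k ∈ range (1 + 1), aco k * gegenbauerSum ((((3 : ℕ) : ℝ) - 2) / 2) k w)
      = fun t => a1 * t := funext hAeval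
  rw [hfun] at hA0
  have ha1 : 0 < a1 := by unfold a1; norm_num
  have hsum0 : ∑ x ∈ C, x = 0 := ThreePointDeficit.sum_eq_zero_of_sharp C a1 ha1 hA0
  exact ⟨hvals, hsum0, Bipyramid5.rigid C hC h5 hsum0 hvals⟩

end Summit.Ventures.PackingBounds.Energy.FivePointRieszTwo
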